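import Summits.QuantumFields.YangMills.Theorems.BalabanLadderNTClassicalShadowOrbitSoft
import Summits.QuantumFields.YangMills.Theorems.BalabanLadderNTClassicalShadowOrbitClosure
import HarnessLib

/-!
# Crux `NT` (stmt-QuantumFields-19353), stub `stub_refpkgT : RefPkgT`: THE CLASSICAL SHADOW, XIV — «every ground state is δ-CLOSE to ONE orbit
# modulo gauge» gives the δ-robust orbit test with the error `24N·δ`, the constants read off ONE configuration

Helper file (`--supports stmt-QuantumFields-19353`) of the fleet lead prover of crux `NT` (unit `ym-spine-19353-p1`, GEN 16); sequel of
`…ClassicalShadowOrbitSoft` (this generation) and `…OrbitClosure` (p613385/p613667).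

WHY.  `…OrbitClosure` turns the EXACT statement `GS(η) ⊆ {g·(γⱼ A)}` into the orbit-sum hypotheses of the orbit test.  What a multi-start
minimisation or an energy estimate delivers is only: every ground state `U` of the box has its density field, seen through the symmetry family,
within `δ` of that of some `g·(γⱼ A)` — `|dens_z(γᵢ U) − dens_z(γᵢ (g·γⱼ A))| ≤ δ` for all `i` at the probed sites `z`.  This file proves that this
APPROXIMATE membership gives the soft orbit sums of `…OrbitSoft` with `Δ₁ = Δ₂ = k·δ`, `Δ₁₂ = 12N·k·δ` (§1–§2), and hence, end to end (§3):

* **`eventually_abs_kerCov_sub_orbitCov_le_of_nearOrbit`** — kernel `γ`-symmetry + δ-closeness of the ground states to the orbit of `A` (closure of the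
  family up to gauge, gauge normalisation) ⇒ for every `ε > 0`, eventually in `β`,
  `|kerCov^η_β(dens_x, dens_y) − Cov_Γ(A; x, y)| ≤ 24N·δ + ε`, where `Cov_Γ(A; x, y) = (1/k)Σᵢ dens_x(γᵢA) dens_y(γᵢA) − ((1/k)Σᵢ dens_x(γᵢA))((1/k)Σᵢ dens_y(γᵢA))`
  is the ORBIT COVARIANCE OF THE DENSITY FIELD OF `A` (the number the kit prints);
* **`orbitCov_le_of_e2osc_nearOrbit`** — clause 2 of the registered package (depth `≥ 1`, any unit `a → 0`, any `ℓ > 0`, constant `C₂`) ⇒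
  `|Cov_Γ(A; x, y)| − 24N·δ ≤ C₂ / min(d_x,d_y)⁴ / (1 + ‖y − x‖)⁴`;
* **`zeroTempCovFloorUnbounded_of_nearOrbit`** — a family of boxes `b → ∞` with reference configurations `A_b`, tolerances `δ_b` and
  `|Cov_Γ(A_b; x_b, y_b)| > c₀ + 24N·δ_b` at unbounded separation ⇒ `ZeroTempCovFloorUnbounded G r` ⇒ clause 2 fails at `(G, r)` for every unit
  (`not_e2osc_of_zeroTempCovFloorUnbounded`).

So the clause-2 kill-path now needs, per box: the kernel symmetries (tree), ONE configuration `A_b` with its orbit covariance (finite arithmetic), and the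
variational input in the CHECKABLE form «every ground state is within δ_b < (|Cov_Γ| − c₀)/(24N) of the orbit of `A_b` in the density observables at two
sites» — a statement an energy estimate (trial upper bound + constrained lower bound) can in principle certify, and the quantity a multi-start search
measures over the minima it finds.

HONEST FRAMING.  Consequences of the registered clauses at fixed lattice geometry as `β → ∞`; δ-closeness, closure and kernel symmetry are HYPOTHESES;
nothing here asserts that such boxes exist; no floor, not AF, not NT, not the seam, not the gap; not Clay.
-/

set_option autoImplicit false

noncomputable section

open MeasureTheory Filter Topology
open Literature.MathematicalPhysics.QuantumFieldTheory Literature.MathematicalPhysics.QuantumLattice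
open Literature.Probability.LatticeModels
open Summit.QuantumFields.YangMills.Cruxes.OSLegsFromFemtoAndGap.DlrCollarTransfer
open Summit.QuantumFields.YangMills.Cruxes.UVSeamRec.BoundaryLawPenetration

namespace Summit.QuantumFields.YangMills.Cruxes.NT.ClassicalShadow

/-! ## §1 Abstract: near an orbit modulo gauge ⇒ orbit sums within `k·δ` -/

section Abstract

variable {G : Type} [Group G] {ι : Type} [Fintype ι]

omit [Group G] in
/-- Termwise `δ`-close finite families have sums within `k·δ`. [folklore] -/
theorem abs_sum_sub_sum_le_card_mul {f g : ι → ℝ} {δ : ℝ} (h : ∀ i, |f i - g i| ≤ δ) :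
    |∑ i, f i - ∑ i, g i| ≤ Fintype.card ι * δ := by
  rw [← Finset.sum_sub_distrib]
  calc |∑ i, (f i - g i)| ≤ ∑ i, |f i - g i| := Finset.abs_sum_le_sum_abs _ _
    _ ≤ ∑ _i : ι, δ := Finset.sum_le_sum fun i _ => h i
    _ = Fintype.card ι * δ := by simp [Finset.sum_const, Finset.card_univ]

omit [Group G] in
/-- Products of bounded termwise `δ`-close families are termwise `(B₁ + B₂)·δ`-close. [folklore] -/
theorem abs_mul_sub_mul_le_of_near {a a' b b' B₁ B₂ δ : ℝ} (ha : |a| ≤ B₁) (hb' : |b'| ≤ B₂)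
    (h₁ : |a - a'| ≤ δ) (h₂ : |b - b'| ≤ δ) : |a * b - a' * b'| ≤ (B₁ + B₂) * δ := by
  have e : a * b - a' * b' = a * (b - b') + (a - a') * b' := by ring
  rw [e]
  calc |a * (b - b') + (a - a') * b'| ≤ |a * (b - b')| + |(a - a') * b'| := abs_add_le _ _
    _ = |a| * |b - b'| + |a - a'| * |b'| := by rw [abs_mul, abs_mul]
    _ ≤ B₁ * δ + δ * B₂ :=
        add_le_add (mul_le_mul ha h₂ (abs_nonneg _) ((abs_nonneg _).trans ha))
          (mul_le_mul h₁ hb' (abs_nonneg _) ((abs_nonneg _).trans h₁))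
    _ = (B₁ + B₂) * δ := by ring

/-- **Near an orbit modulo gauge ⇒ orbit sum near.**  For a finite family `γ` closed under composition up to re-indexing and gauge, normalising the
gauge group, a gauge-invariant `O`, and a configuration `U` whose `γ`-images are `δ`-close IN `O` to those of `g·(γⱼ A)`:
`|Σᵢ O(γᵢ U) − Σᵢ O(γᵢ A)| ≤ k·δ`. [folklore] -/
theorem abs_orbitSum_sub_le_of_nearOrbitModGauge (γ : ι → LGConfig 4 G → LGConfig 4 G)
    (hmul : ∀ j : ι, ∃ e : ι ≃ ι, ∀ (k : ι) (U : LGConfig 4 G), ∃ h : Site 4 → G, γ k (γ j U) = gaugeTransformZd h (γ (e k) U))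
    (hgauge : ∀ (i : ι) (g : Site 4 → G), ∃ g' : Site 4 → G, ∀ U : LGConfig 4 G, γ i (gaugeTransformZd g U) = gaugeTransformZd g' (γ i U))
    {O : LGConfig 4 G → ℝ} (hO : IsZdGaugeInvariant O) (A : LGConfig 4 G) {U : LGConfig 4 G} {δ : ℝ} (j : ι) (g : Site 4 → G)
    (hnear : ∀ i, |O (γ i U) - O (γ i (gaugeTransformZd g (γ j A)))| ≤ δ) :
    |∑ i, O (γ i U) - ∑ i, O (γ i A)| ≤ Fintype.card ι * δ := by
  rw [← orbitSum_eq_of_oneOrbitModGauge' γ hmul hgauge hO A j g]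
  exact abs_sum_sub_sum_le_card_mul hnear

/-- **Near an orbit modulo gauge ⇒ orbit sum of a PRODUCT of two bounded gauge-invariant observables near**, tolerance `k·(B₁+B₂)·δ`. [folklore] -/
theorem abs_orbitSum_mul_sub_le_of_nearOrbitModGauge (γ : ι → LGConfig 4 G → LGConfig 4 G)
    (hmul : ∀ j : ι, ∃ e : ι ≃ ι, ∀ (k : ι) (U : LGConfig 4 G), ∃ h : Site 4 → G, γ k (γ j U) = gaugeTransformZd h (γ (e k) U))
    (hgauge : ∀ (i : ι) (g : Site 4 → G), ∃ g' : Site 4 → G, ∀ U : LGConfig 4 G, γ i (gaugeTransformZd g U) = gaugeTransformZd g' (γ i U))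
    {O₁ O₂ : LGConfig 4 G → ℝ} (hO₁ : IsZdGaugeInvariant O₁) (hO₂ : IsZdGaugeInvariant O₂) {B₁ B₂ : ℝ}
    (hB₁ : ∀ U, |O₁ U| ≤ B₁) (hB₂ : ∀ U, |O₂ U| ≤ B₂) (A : LGConfig 4 G) {U : LGConfig 4 G} {δ : ℝ} (j : ι) (g : Site 4 → G)
    (hnear₁ : ∀ i, |O₁ (γ i U) - O₁ (γ i (gaugeTransformZd g (γ j A)))| ≤ δ)
    (hnear₂ : ∀ i, |O₂ (γ i U) - O₂ (γ i (gaugeTransformZd g (γ j A)))| ≤ δ) :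
    |∑ i, O₁ (γ i U) * O₂ (γ i U) - ∑ i, O₁ (γ i A) * O₂ (γ i A)| ≤ Fintype.card ι * ((B₁ + B₂) * δ) := by
  have hO : IsZdGaugeInvariant fun V => O₁ V * O₂ V := fun g' V => by
    show O₁ _ * O₂ _ = O₁ V * O₂ V
    rw [hO₁ g', hO₂ g']
  rw [← orbitSum_eq_of_oneOrbitModGauge' γ hmul hgauge hO A j g]
  exact abs_sum_sub_sum_le_card_mul fun i => abs_mul_sub_mul_le_of_near (hB₁ _) (hB₂ _) (hnear₁ i) (hnear₂ i)

end Abstract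

/-! ## §2 The soft orbit-sum hypotheses on the ground states -/

section GroundStates

variable {G : Type} [Group G] [TopologicalSpace G] [IsTopologicalGroup G] [CompactSpace G]
  [MeasurableSpace G] [BorelSpace G] (r : LatticeRep G) {ι : Type} [Fintype ι]

/-- **Soft `h₁`/`h₂`**: if every ground state of the cube `(c, b)` with exterior `η` is, in the density at `x` seen through the family `γ`, within `δ` of a
gauge transform of a `γ`-image of ONE configuration `A`, then the orbit sum of `dens_x` is within `k·δ` of its value on `A` on the ground states. [folklore] -/
theorem softOrbitSums_dens_of_nearOrbitModGauge (c : Fin 4 → ℤ) (b : ℕ) (η : LGConfig 4 G) (γ : ι → LGConfig 4 G → LGConfig 4 G)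
    (hmul : ∀ j : ι, ∃ e : ι ≃ ι, ∀ (k : ι) (U : LGConfig 4 G), ∃ h : Site 4 → G, γ k (γ j U) = gaugeTransformZd h (γ (e k) U))
    (hgauge : ∀ (i : ι) (g : Site 4 → G), ∃ g' : Site 4 → G, ∀ U : LGConfig 4 G, γ i (gaugeTransformZd g U) = gaugeTransformZd g' (γ i U))
    (A : LGConfig 4 G) (x : Fin 4 → ℤ) {δ : ℝ}
    (hGS : ∀ ζ ∈ cubeMinimisers G r c b η, ∃ (j : ι) (g : Site 4 → G), ∀ i,
      |dens G r x (γ i (glueWith (cubeEdges c b) ζ η)) - dens G r x (γ i (gaugeTransformZd g (γ j A)))| ≤ δ) :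
    ∀ ζ ∈ cubeMinimisers G r c b η,
      |∑ i, dens G r x (γ i (glueWith (cubeEdges c b) ζ η)) - ∑ i, dens G r x (γ i A)| ≤ Fintype.card ι * δ := by
  intro ζ hζ
  obtain ⟨j, g, hj⟩ := hGS ζ hζ
  exact abs_orbitSum_sub_le_of_nearOrbitModGauge γ hmul hgauge (fun g' U => dens_gaugeTransformZd r g' x U) A j g hj

/-- **Soft `h₁₂`** (products of densities at two sites, JOINT witness): tolerance `k·(12N·δ)`. [folklore] -/
theorem softOrbitSums_dens_mul_of_nearOrbitModGauge (c : Fin 4 → ℤ) (b : ℕ) (η : LGConfig 4 G) (γ : ι → LGConfig 4 G → LGConfig 4 G)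
    (hmul : ∀ j : ι, ∃ e : ι ≃ ι, ∀ (k : ι) (U : LGConfig 4 G), ∃ h : Site 4 → G, γ k (γ j U) = gaugeTransformZd h (γ (e k) U))
    (hgauge : ∀ (i : ι) (g : Site 4 → G), ∃ g' : Site 4 → G, ∀ U : LGConfig 4 G, γ i (gaugeTransformZd g U) = gaugeTransformZd g' (γ i U))
    (A : LGConfig 4 G) (x y : Fin 4 → ℤ) {δ : ℝ}
    (hGS : ∀ ζ ∈ cubeMinimisers G r c b η, ∃ (j : ι) (g : Site 4 → G), ∀ i,
      |dens G r x (γ i (glueWith (cubeEdges c b) ζ η)) - dens G r x (γ i (gaugeTransformZd g (γ j A)))| ≤ δ ∧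
      |dens G r y (γ i (glueWith (cubeEdges c b) ζ η)) - dens G r y (γ i (gaugeTransformZd g (γ j A)))| ≤ δ) :
    ∀ ζ ∈ cubeMinimisers G r c b η,
      |∑ i, dens G r x (γ i (glueWith (cubeEdges c b) ζ η)) * dens G r y (γ i (glueWith (cubeEdges c b) ζ η)) -
          ∑ i, dens G r x (γ i A) * dens G r y (γ i A)| ≤ Fintype.card ι * (12 * r.N * δ) := by
  intro ζ hζ
  obtain ⟨j, g, hj⟩ := hGS ζ hζ
  have h := abs_orbitSum_mul_sub_le_of_nearOrbitModGauge γ hmul hgauge (fun g' U => dens_gaugeTransformZd r g' x U)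
    (fun g' U => dens_gaugeTransformZd r g' y U) (CornerPrice.abs_dens_le G r x) (CornerPrice.abs_dens_le G r y) A j g
    (fun i => (hj i).1) (fun i => (hj i).2)
  have e : (6 * (r.N : ℝ) + 6 * r.N) * δ = 12 * r.N * δ := by ring
  rwa [e] at h

/-- The orbit mean of a density is bounded by `6N`: `|Σᵢ dens_x(γᵢ A)/k| ≤ 6N`. [folklore] -/
theorem abs_orbitMean_dens_le [Nonempty ι] (γ : ι → LGConfig 4 G → LGConfig 4 G) (A : LGConfig 4 G) (x : Fin 4 → ℤ) :
    |(∑ i, dens G r x (γ i A)) / Fintype.card ι| ≤ 6 * r.N := by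
  have hk : (0 : ℝ) < Fintype.card ι := Nat.cast_pos.2 Fintype.card_pos
  rw [abs_div, abs_of_pos hk, div_le_iff₀ hk]
  calc |∑ i, dens G r x (γ i A)| ≤ ∑ i, |dens G r x (γ i A)| := Finset.abs_sum_le_sum_abs _ _
    _ ≤ ∑ _i : ι, 6 * (r.N : ℝ) := Finset.sum_le_sum fun i _ => CornerPrice.abs_dens_le G r x _
    _ = 6 * r.N * Fintype.card ι := by simp [Finset.sum_const, Finset.card_univ]; ring

end GroundStates

/-! ## §3 End to end: the δ-robust orbit test with ONE configuration -/

section EndToEnd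

variable {G : Type} [Group G] [TopologicalSpace G] [IsTopologicalGroup G] [CompactSpace G]
  [MeasurableSpace G] [BorelSpace G] (r : LatticeRep G) {ι : Type} [Fintype ι] [Nonempty ι]

/-- The error budget of `…OrbitSoft` at `Δ₁ = Δ₂ = kδ`, `Δ₁₂ = 12N·kδ` is at most `24N·δ`. [folklore] -/
theorem softError_le (γ : ι → LGConfig 4 G → LGConfig 4 G) (A : LGConfig 4 G) (x : Fin 4 → ℤ) {δ : ℝ} (hδ : 0 ≤ δ) :
    Fintype.card ι * (12 * r.N * δ) / Fintype.card ι + 6 * r.N * (Fintype.card ι * δ / Fintype.card ι) +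
        |(∑ i, dens G r x (γ i A)) / Fintype.card ι| * (Fintype.card ι * δ / Fintype.card ι) ≤ 24 * r.N * δ := by
  have hk : (0 : ℝ) < Fintype.card ι := Nat.cast_pos.2 Fintype.card_pos
  have e1 : (Fintype.card ι : ℝ) * (12 * r.N * δ) / Fintype.card ι = 12 * r.N * δ := by field_simp
  have e2 : (Fintype.card ι : ℝ) * δ / Fintype.card ι = δ := by field_simp
  rw [e1, e2]
  have hM := abs_orbitMean_dens_le r γ A x
  nlinarith [hM, hδ, abs_nonneg ((∑ i, dens G r x (γ i A)) / Fintype.card ι)]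

/-- **δ-robust orbit test with ONE configuration.**  Kernel `γ`-symmetry (on continuous observables), closure of `γ` up to re-indexing and gauge,
gauge normalisation, and δ-CLOSENESS of every ground state to the orbit of `A` in the densities at `x` and `y` ⇒ for every `ε > 0`, eventually in `β`,
`|kerCov^η_β(dens_x, dens_y) − Cov_Γ(A; x, y)| ≤ 24N·δ + ε`. [folklore] -/
theorem eventually_abs_kerCov_sub_orbitCov_le_of_nearOrbit (c : Fin 4 → ℤ) (b : ℕ) (η : LGConfig 4 G)
    (γ : ι → LGConfig 4 G → LGConfig 4 G) (hγ : ∀ i, Continuous (γ i))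
    (hmul : ∀ j : ι, ∃ e : ι ≃ ι, ∀ (k : ι) (U : LGConfig 4 G), ∃ h : Site 4 → G, γ k (γ j U) = gaugeTransformZd h (γ (e k) U))
    (hgauge : ∀ (i : ι) (g : Site 4 → G), ∃ g' : Site 4 → G, ∀ U : LGConfig 4 G, γ i (gaugeTransformZd g U) = gaugeTransformZd g' (γ i U))
    (hsymm : ∀ (β : ℝ) (i : ι) (F : LGConfig 4 G → ℝ), Continuous F → kerE G r β c b η (F ∘ γ i) = kerE G r β c b η F)
    (A : LGConfig 4 G) {x y : Fin 4 → ℤ} {δ : ℝ}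
    (hGS : ∀ ζ ∈ cubeMinimisers G r c b η, ∃ (j : ι) (g : Site 4 → G), ∀ i,
      |dens G r x (γ i (glueWith (cubeEdges c b) ζ η)) - dens G r x (γ i (gaugeTransformZd g (γ j A)))| ≤ δ ∧
      |dens G r y (γ i (glueWith (cubeEdges c b) ζ η)) - dens G r y (γ i (gaugeTransformZd g (γ j A)))| ≤ δ)
    {ε : ℝ} (hε : 0 < ε) :
    ∀ᶠ β : ℝ in atTop, |kerCov G r β c b η (dens G r x) (dens G r y) -
        ((∑ i, dens G r x (γ i A) * dens G r y (γ i A)) / Fintype.card ι -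
          (∑ i, dens G r x (γ i A)) / Fintype.card ι * ((∑ i, dens G r y (γ i A)) / Fintype.card ι))| ≤ 24 * r.N * δ + ε := by
  have hδ : 0 ≤ δ := by
    obtain ⟨ζ, hζ⟩ := cubeMinimisers_nonempty (G := G) (r := r) c b η
    obtain ⟨j, g, hj⟩ := hGS ζ hζ
    obtain ⟨i⟩ := ‹Nonempty ι›
    exact (abs_nonneg _).trans (hj i).1
  have h₁ := softOrbitSums_dens_of_nearOrbitModGauge r c b η γ hmul hgauge A x (δ := δ)
    (fun ζ hζ => by obtain ⟨j, g, hj⟩ := hGS ζ hζ; exact ⟨j, g, fun i => (hj i).1⟩)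
  have h₂ := softOrbitSums_dens_of_nearOrbitModGauge r c b η γ hmul hgauge A y (δ := δ)
    (fun ζ hζ => by obtain ⟨j, g, hj⟩ := hGS ζ hζ; exact ⟨j, g, fun i => (hj i).2⟩)
  have h₁₂ := softOrbitSums_dens_mul_of_nearOrbitModGauge r c b η γ hmul hgauge A x y hGS
  have hsoft := eventually_abs_kerCov_sub_orbitCov_le r c b η γ hγ
    (M₁ := ∑ i, dens G r x (γ i A)) (M₂ := ∑ i, dens G r y (γ i A)) (M₁₂ := ∑ i, dens G r x (γ i A) * dens G r y (γ i A))
    (fun ζ hζ => h₁ ζ hζ) (fun ζ hζ => h₂ ζ hζ) (fun ζ hζ => h₁₂ ζ hζ)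
    (fun β i => hsymm β i _ (continuous_dens r x)) (fun β i => hsymm β i _ (continuous_dens r y))
    (fun β i => hsymm β i _ ((continuous_dens r x).mul (continuous_dens r y))) hε
  have hE := softError_le r γ A x hδ
  filter_upwards [hsoft] with β hβ
  exact hβ.trans (by linarith)

variable (a : ℝ → ℝ)

/-- **Clause 2 prices a box whose ground states are δ-close to one orbit by the orbit covariance of ONE configuration minus `24N·δ`**, at any two
cube sites (boundary layer included): `|Cov_Γ(A; x, y)| − 24N·δ ≤ C₂ / min(d_x,d_y)⁴ / (1 + ‖y − x‖)⁴`. [folklore] -/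
theorem orbitCov_le_of_e2osc_nearOrbit (ha0 : Tendsto a atTop (𝓝 0)) {C₂ ℓ : ℝ} (hℓ : 0 < ℓ)
    (hE2 : ∃ β₂ : ℝ, ∀ β : ℝ, β₂ ≤ β → ∀ (c : Fin 4 → ℤ) (b : ℕ), (b : ℝ) * a β ≤ ℓ →
      ∀ (η η' : LGConfig 4 G) (x y : Fin 4 → ℤ), 1 ≤ depth c b x → 1 ≤ depth c b y →
        |kerCov G r β c b η (dens G r x) (dens G r y) - kerCov G r β c b η' (dens G r x) (dens G r y)| ≤
          C₂ / ((min (depth c b x) (depth c b y) : ℕ) : ℝ) ^ 4 / (1 + ‖siteToE (y - x)‖) ^ 4)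
    (c : Fin 4 → ℤ) (b : ℕ) (η : LGConfig 4 G) (γ : ι → LGConfig 4 G → LGConfig 4 G) (hγ : ∀ i, Continuous (γ i))
    (hmul : ∀ j : ι, ∃ e : ι ≃ ι, ∀ (k : ι) (U : LGConfig 4 G), ∃ h : Site 4 → G, γ k (γ j U) = gaugeTransformZd h (γ (e k) U))
    (hgauge : ∀ (i : ι) (g : Site 4 → G), ∃ g' : Site 4 → G, ∀ U : LGConfig 4 G, γ i (gaugeTransformZd g U) = gaugeTransformZd g' (γ i U))
    (hsymm : ∀ (β : ℝ) (i : ι) (F : LGConfig 4 G → ℝ), Continuous F → kerE G r β c b η (F ∘ γ i) = kerE G r β c b η F)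
    (A : LGConfig 4 G) {x y : Fin 4 → ℤ} (hx : 1 ≤ depth c b x) (hy : 1 ≤ depth c b y) {δ : ℝ}
    (hGS : ∀ ζ ∈ cubeMinimisers G r c b η, ∃ (j : ι) (g : Site 4 → G), ∀ i,
      |dens G r x (γ i (glueWith (cubeEdges c b) ζ η)) - dens G r x (γ i (gaugeTransformZd g (γ j A)))| ≤ δ ∧
      |dens G r y (γ i (glueWith (cubeEdges c b) ζ η)) - dens G r y (γ i (gaugeTransformZd g (γ j A)))| ≤ δ) :
    |(∑ i, dens G r x (γ i A) * dens G r y (γ i A)) / Fintype.card ι -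
          (∑ i, dens G r x (γ i A)) / Fintype.card ι * ((∑ i, dens G r y (γ i A)) / Fintype.card ι)| - 24 * r.N * δ ≤
      C₂ / ((min (depth c b x) (depth c b y) : ℕ) : ℝ) ^ 4 / (1 + ‖siteToE (y - x)‖) ^ 4 := by
  obtain ⟨β₂, H2⟩ := hE2
  refine le_of_forall_pos_le_add fun e he => ?_
  have he2 : 0 < e / 2 := half_pos he
  have h0 : ∀ᶠ β : ℝ in atTop, |kerCov G r β c b 1 (dens G r x) (dens G r y)| ≤ e / 2 := by
    have h := (tendsto_kerCov_one_dens_all r c b x y).abs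
    rw [abs_zero] at h
    exact (h.eventually (eventually_le_nhds he2)).mono fun _ h => h
  have hsoft := eventually_abs_kerCov_sub_orbitCov_le_of_nearOrbit r c b η γ hγ hmul hgauge hsymm A hGS he2
  obtain ⟨β, hβ0, hβs, hb, hβ2⟩ := (h0.and (hsoft.and ((eventually_mul_le_of_tendsto_zero ha0 hℓ b).and
    (eventually_ge_atTop β₂)))).exists
  have hosc := H2 β hβ2 c b hb η 1 x y hx hy
  set K : ℝ := (∑ i, dens G r x (γ i A) * dens G r y (γ i A)) / Fintype.card ι -
    (∑ i, dens G r x (γ i A)) / Fintype.card ι * ((∑ i, dens G r y (γ i A)) / Fintype.card ι) with hK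
  have t1 := (abs_sub_abs_le_abs_sub K (kerCov G r β c b η (dens G r x) (dens G r y))).trans_eq
    (abs_sub_comm K (kerCov G r β c b η (dens G r x) (dens G r y)))
  have t2 := abs_sub_abs_le_abs_sub (kerCov G r β c b η (dens G r x) (dens G r y)) (kerCov G r β c b 1 (dens G r x) (dens G r y))
  linarith

/-- **Near-orbit family ⇒ unbounded zero-temperature floor ⇒ `¬` clause 2.**  Suppose that for every `n` there are a cube, an exterior `η`, a finite
non-empty family `γ` of continuous maps closed up to re-indexing and gauge, normalising the gauge group and leaving the cube kernel of `η` invariant,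
ONE configuration `A`, two cube sites `x, y` (depth `≥ 1`) at separation `≥ n`, and a tolerance `δ` such that every ground state is δ-close to the
orbit of `A` in the densities at `x, y`, with `c₀ + 24N·δ < |Cov_Γ(A; x, y)|`.  Then `ZeroTempCovFloorUnbounded G r`. [folklore] -/
theorem zeroTempCovFloorUnbounded_of_nearOrbit {c₀ : ℝ} (hc₀ : 0 < c₀)
    (h : ∀ n : ℕ, ∃ (c : Fin 4 → ℤ) (b : ℕ) (η : LGConfig 4 G) (γ : ι → LGConfig 4 G → LGConfig 4 G) (A : LGConfig 4 G)
      (x y : Fin 4 → ℤ) (δ : ℝ),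
      (∀ i, Continuous (γ i)) ∧
      (∀ j : ι, ∃ e : ι ≃ ι, ∀ (k : ι) (U : LGConfig 4 G), ∃ h : Site 4 → G, γ k (γ j U) = gaugeTransformZd h (γ (e k) U)) ∧
      (∀ (i : ι) (g : Site 4 → G), ∃ g' : Site 4 → G, ∀ U : LGConfig 4 G, γ i (gaugeTransformZd g U) = gaugeTransformZd g' (γ i U)) ∧
      (∀ (β : ℝ) (i : ι) (F : LGConfig 4 G → ℝ), Continuous F → kerE G r β c b η (F ∘ γ i) = kerE G r β c b η F) ∧
      1 ≤ depth c b x ∧ 1 ≤ depth c b y ∧ (n : ℝ) ≤ ‖siteToE (y - x)‖ ∧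
      (∀ ζ ∈ cubeMinimisers G r c b η, ∃ (j : ι) (g : Site 4 → G), ∀ i,
        |dens G r x (γ i (glueWith (cubeEdges c b) ζ η)) - dens G r x (γ i (gaugeTransformZd g (γ j A)))| ≤ δ ∧
        |dens G r y (γ i (glueWith (cubeEdges c b) ζ η)) - dens G r y (γ i (gaugeTransformZd g (γ j A)))| ≤ δ) ∧
      c₀ + 24 * r.N * δ < |(∑ i, dens G r x (γ i A) * dens G r y (γ i A)) / Fintype.card ι -
          (∑ i, dens G r x (γ i A)) / Fintype.card ι * ((∑ i, dens G r y (γ i A)) / Fintype.card ι)|) :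
    ZeroTempCovFloorUnbounded G r := by
  refine zeroTempCovFloorUnbounded_of_nondecaying r hc₀ fun n => ?_
  obtain ⟨c, b, η, γ, A, x, y, δ, hγ, hmul, hgauge, hsymm, hx, hy, hsep, hGS, hgap⟩ := h n
  refine ⟨c, b, η, x, y, hx, hy, hsep, Filter.Eventually.frequently ?_⟩
  set K : ℝ := (∑ i, dens G r x (γ i A) * dens G r y (γ i A)) / Fintype.card ι -
    (∑ i, dens G r x (γ i A)) / Fintype.card ι * ((∑ i, dens G r y (γ i A)) / Fintype.card ι) with hK
  have hε : 0 < |K| - 24 * r.N * δ - c₀ := by linarith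
  have hsoft := eventually_abs_kerCov_sub_orbitCov_le_of_nearOrbit r c b η γ hγ hmul hgauge hsymm A hGS hε
  filter_upwards [hsoft] with β hβ
  have t1 := (abs_sub_abs_le_abs_sub K (kerCov G r β c b η (dens G r x) (dens G r y))).trans_eq
    (abs_sub_comm K (kerCov G r β c b η (dens G r x) (dens G r y)))
  linarith

/-- **Clause 1, near-orbit form**: δ-closeness of the ground states to the orbit of `A` in the density at `x` prices the orbit-MEAN deficit of `A`:
`6N − (1/k)Σᵢ dens_x(γᵢ A) − δ ≤ C₁/d_x⁴`. [folklore] -/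
theorem orbitMean_deficit_le_of_e1osc_nearOrbit (ha0 : Tendsto a atTop (𝓝 0)) {C₁ ℓ : ℝ} (hℓ : 0 < ℓ)
    (hE1 : ∃ β₁ : ℝ, ∀ β : ℝ, β₁ ≤ β → ∀ (c : Fin 4 → ℤ) (b : ℕ), (b : ℝ) * a β ≤ ℓ →
      ∀ (η η' : LGConfig 4 G) (x : Fin 4 → ℤ), 1 ≤ depth c b x →
        |kerE G r β c b η (dens G r x) - kerE G r β c b η' (dens G r x)| ≤ C₁ / (depth c b x : ℝ) ^ 4)
    (c : Fin 4 → ℤ) (b : ℕ) (η : LGConfig 4 G) (γ : ι → LGConfig 4 G → LGConfig 4 G) (hγ : ∀ i, Continuous (γ i))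
    (hmul : ∀ j : ι, ∃ e : ι ≃ ι, ∀ (k : ι) (U : LGConfig 4 G), ∃ h : Site 4 → G, γ k (γ j U) = gaugeTransformZd h (γ (e k) U))
    (hgauge : ∀ (i : ι) (g : Site 4 → G), ∃ g' : Site 4 → G, ∀ U : LGConfig 4 G, γ i (gaugeTransformZd g U) = gaugeTransformZd g' (γ i U))
    (hsymm : ∀ (β : ℝ) (i : ι) (F : LGConfig 4 G → ℝ), Continuous F → kerE G r β c b η (F ∘ γ i) = kerE G r β c b η F)
    (A : LGConfig 4 G) {x : Fin 4 → ℤ} (hx : 1 ≤ depth c b x) {δ : ℝ}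
    (hGS : ∀ ζ ∈ cubeMinimisers G r c b η, ∃ (j : ι) (g : Site 4 → G), ∀ i,
      |dens G r x (γ i (glueWith (cubeEdges c b) ζ η)) - dens G r x (γ i (gaugeTransformZd g (γ j A)))| ≤ δ) :
    6 * (r.N : ℝ) - (∑ i, dens G r x (γ i A)) / Fintype.card ι - δ ≤ C₁ / (depth c b x : ℝ) ^ 4 := by
  have hk : (0 : ℝ) < Fintype.card ι := Nat.cast_pos.2 Fintype.card_pos
  have h₁ := softOrbitSums_dens_of_nearOrbitModGauge r c b η γ hmul hgauge A x hGS
  have h := orbitMean_deficit_le_of_e1osc_soft r a ha0 hℓ hE1 c b η γ hγ hx (fun ζ hζ => h₁ ζ hζ)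
    (fun β i => hsymm β i _ (continuous_dens r x))
  have e : (Fintype.card ι : ℝ) * δ / Fintype.card ι = δ := by field_simp
  rwa [e] at h

end EndToEnd

end Summit.QuantumFields.YangMills.Cruxes.NT.ClassicalShadow

end
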